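import Literature.AnabelianGeometry.AbsoluteAnabelian.MLFGaloisGroups
import Literature.NumberTheory.GaloisRepresentations.UnramifiedKummer
import Literature.NumberTheory.GaloisRepresentations.TameInertiaKummerProofs
import Literature.NumberTheory.GaloisRepresentations.LocalGaloisGroupProofs
import Mathlib.NumberTheory.Padics.ValuativeRel
import Mathlib.FieldTheory.Galois.Infinite
import HarnessLib

/-!
# Bridge: the elementary inertia group of `MLFGaloisGroups.lean` is the inertia group of the
# valued model, and `I_K ≤ Gal(K̄/E) ↔ E ⊆ K^unr`

abc-iut-L4-t4's `MLFGaloisGroups.lean` models an MLF `K` by `[Algebra ℚ_[p] K] [FiniteDimensional]`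
and defines the inertia group ELEMENTARILY, `inertiaSubgroupMLF p K = Gal(K̄/K(μ_{(p')}))` (fixator
of the prime-to-`p` roots of unity of `K̄`); the tree's local Galois theory (valued model,
`[IsNonarchimedeanLocalField K]`) has `absInertia K` (Mathlib `Ideal.inertia` of the canonical prime
of `K̄`) and PROVES `absInertia K = Gal(K̄/K(μ_{(p')}))` (`mem_absInertia_iff_smul_rootsOfUnity`,
`mem_absInertia_iff_forall_mem_maxUnramified`; Serre, *Local Fields* IV §4 Cor. 2 to Prop. 16).
This proof-only file records the bridge statements consumed by the discharge of the named fact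
`mlf_unramified_criterion` (`MLFReciprocityInputs.lean`, [AbsAnab] Prop 1.2.1 (ii)):

* `ringChar_residueField_eq_of_valuativeExtension`: a valued local field `K` that is a valuative
  extension of `ℚ_p` has residue characteristic `p`;
* `inertiaSubgroupMLF_eq_absInertia`: for such `K`, `inertiaSubgroupMLF p K = absInertia K`;
* `inertiaSubgroupMLF_le_iff_le_maxUnramified`: `I_K ≤ Gal(K̄/E) ↔ E ≤ K^unr = maxUnramified K`
  for every subextension `E ⊆ K̄` (infinite Galois theory: `K^unr` is the fixed field of `I_K`).

With the PROVED bridge `FiniteExtension.isNonarchimedeanLocalField ℚ_[p] K` /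
`FiniteExtension.valuativeExtension` every ℚ_p-model MLF is such a `K`.  Proof-only: no definitions.
-/

noncomputable section

open scoped Valued
open ValuativeRel Field

namespace Literature.AnabelianGeometry.AbsoluteAnabelian

open Literature.NumberTheory.GaloisRepresentations
open Literature.NumberTheory.GaloisRepresentations.IsNonarchimedeanLocalField

variable {K : Type} [Field K] [ValuativeRel K] [TopologicalSpace K] [IsNonarchimedeanLocalField K]

/-- A non-archimedean local field which is a valuative extension of `ℚ_p` has residue
characteristic `p` (`v(p) < 1`, so `p ∈ 𝔪_K`).  Serre, *Local Fields*, Ch. II §5 ("a local field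
of characteristic `0` with residue field of characteristic `p` is a finite extension of `ℚ_p`", and
conversely). [cite: SerreLocalFields1979, Ch. II §5] -/
theorem ringChar_residueField_eq_of_valuativeExtension (p : ℕ) [Fact p.Prime] [Algebra ℚ_[p] K]
    [ValuativeExtension ℚ_[p] K] : ringChar 𝓀[K] = p := by
  have hp : Nat.Prime p := Fact.out
  -- `v_K(p) < 1`
  have hlt : valuation K (p : K) < 1 := by
    have h1 : ¬ ((1 : K) ≤ᵥ (p : K)) := by
      rw [show (p : K) = algebraMap ℚ_[p] K (p : ℚ_[p]) by simp,
        show (1 : K) = algebraMap ℚ_[p] K 1 by simp, ValuativeExtension.vle_iff_vle,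
        Valuation.vle_iff_le (v := valuation ℚ_[p]), map_one, not_le]
      exact Padic.valuation_p_lt_one _
    rw [Valuation.vle_iff_le (v := valuation K), map_one, not_le] at h1
    exact h1
  -- hence `p ∈ 𝓂[K]` and `(p : 𝓀[K]) = 0`
  have hmem : ((p : ℕ) : 𝒪[K]) ∈ 𝓂[K] := by
    rw [mem_maximalIdeal_iff_valuation_lt_one]
    exact_mod_cast hlt
  have h0 : ((p : ℕ) : 𝓀[K]) = 0 := by
    rw [← map_natCast (IsLocalRing.residue 𝒪[K]), IsLocalRing.residue_eq_zero_iff]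
    exact hmem
  exact CharP.ringChar_of_prime_eq_zero hp h0

/-- **The two inertia groups agree**: for a non-archimedean local field `K` of residue
characteristic `p`, the elementary `inertiaSubgroupMLF p K` (fixator of the prime-to-`p` roots of
unity of `K̄`) equals `absInertia K` — the tree's `mem_absInertia_iff_smul_rootsOfUnity`
(`I_K = Gal(K̄/K(μ_{(p')}))`, Serre IV §4 Cor. 2 to Prop. 16), with "`N` a unit of `𝒪_K`"
translated into "`p ∤ N`". [cite: SerreLocalFields1979, Ch. IV §4 Cor. 2 to Prop. 16] -/
theorem inertiaSubgroupMLF_eq_absInertia {p : ℕ} [Fact p.Prime] (hp : ringChar 𝓀[K] = p) :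
    inertiaSubgroupMLF p K = absInertia K := by
  ext σ
  rw [inertiaSubgroupMLF, mem_fixingSubgroup_iff, mem_absInertia_iff_smul_rootsOfUnity]
  constructor
  · intro h N hN ζ hζ
    have hN' := pos_and_not_ringChar_dvd_of_isUnit_natCast hN
    rw [hp] at hN'
    exact h ζ ⟨N, hN'.1, hN'.2, hζ⟩
  · rintro h ζ ⟨n, hn, hpn, hζ⟩
    rw [← hp] at hpn
    exact h n (isUnit_natCast_of_not_ringChar_dvd K hpn) ζ hζ

/-- **`I_K ≤ Gal(K̄/E) ↔ E ⊆ K^unr`** for a subextension `E ⊆ K̄`: `K^unr = maxUnramified K =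
K(μ_{(p')})` is the fixed field of `I_K` (`mem_absInertia_iff_forall_mem_maxUnramified` and the
fundamental theorem of infinite Galois theory).
[cite: SerreLocalFields1979, Ch. IV §4 Cor. 2 to Prop. 16] -/
theorem inertiaSubgroupMLF_le_iff_le_maxUnramified [CharZero K] {p : ℕ} [Fact p.Prime]
    (hp : ringChar 𝓀[K] = p) (E : IntermediateField K (AlgebraicClosure K)) :
    inertiaSubgroupMLF p K ≤
        E.fixingSubgroup.comap (absoluteGaloisGroup.toAlgEquiv K).toMonoidHom ↔
      E ≤ maxUnramified K := by
  rw [inertiaSubgroupMLF_eq_absInertia hp]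
  -- `absInertia K = Gal(K̄/K^unr)` as subgroups of `K̄ ≃ₐ[K] K̄`
  have hI : (maxUnramified K).fixingSubgroup.comap (absoluteGaloisGroup.toAlgEquiv K).toMonoidHom =
      absInertia K := by
    ext σ
    rw [Subgroup.mem_comap, mem_absInertia_iff_forall_mem_maxUnramified]
    change absoluteGaloisGroup.toAlgEquiv K σ ∈ _ ↔ _
    rw [IntermediateField.mem_fixingSubgroup_iff]
    rfl
  constructor
  · intro h
    -- `E ≤ fixedField (I_K) = K^unr`
    have hle : (maxUnramified K).fixingSubgroup ≤ E.fixingSubgroup := by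
      intro τ hτ
      have : (absoluteGaloisGroup.toAlgEquiv K).symm τ ∈ absInertia K := by
        rw [← hI, Subgroup.mem_comap]
        exact hτ
      have h2 := h this
      rw [Subgroup.mem_comap] at h2
      exact h2
    haveI : IsGalois K (AlgebraicClosure K) := inferInstance
    rw [← InfiniteGalois.fixedField_fixingSubgroup (maxUnramified K), IntermediateField.le_iff_le]
    exact hle
  · intro h σ hσ
    rw [← hI, Subgroup.mem_comap] at hσ
    rw [Subgroup.mem_comap]
    exact IntermediateField.fixingSubgroup_antitone h hσ

end Literature.AnabelianGeometry.AbsoluteAnabelian
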